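import Summits.Ventures.PercRepro.PuncturedLYMRerouteCols
import Summits.Ventures.PercRepro.PuncturedLYMProfileSum

/-!
# PercRepro — (SP) BY SUPERPOSITION, PART 5: THEOREM A — (SP) HOLDS FOR EVERY CODE WITH `3j ≤ n + 1` (p10, gen 31)

The corrected superposition `totalW` (PuncturedLYMReroute / PuncturedLYMRerouteCols) has row sums `1` on `P` and column
sums exactly `#P/#Y`; it is a coupling of the uniform measures as soon as it is nonnegative.  In units of `1/(n−j)`:
* `superW_ge` — the superposition is at least `1 − N(X)`, `N(X) = Σ_{B ∈ D} e(#(X ∩ B))` (every word deviates from uniform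
  by `+g(a) ≥ 0` at an inside completion and by `−e(a)` at an outside one);
* `errE_le`, `max_errE_le` — the positive error of a word `B` is at most `N'(B) = Σ_{B' ≠ B} e(#(B ∩ B'))`;
* with the profile bound `N(X), N'(B) ≤ j/(n − j + 1)` (PuncturedLYMProfile) and the re-routing bound
  `Σ_B reroute ≥ −max errE⁺` (PuncturedLYMReroute): `(n−j)·totalW ≥ 1 − 2j/(n − j + 1) ≥ 0` when `3j ≤ n + 1`;
* **`puncturedNMP_of_three_j`** — (SP) for every code `D ⊆ C([n], j)` with `1 ≤ j`, `2j + 1 ≤ n` and `3j ≤ n + 1`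
  (the master lemma `puncturedNMP_of_weights` on `totalW / (#P/#Y)`).
The regime `2j + 1 ≤ n ≤ 3j − 2` is NOT claimed (the same coupling is nonnegative on every instance tested).
-/

namespace PercRepro.PuncturedLYM

open Finset

variable {α : Type} [Fintype α] [DecidableEq α]

/-! ### The superposition is at least `1 − N(X)` -/

/-- One radial coupling at a completion `X ↦ insert y X` is at least `(1 − e(#(X ∩ B)))/(n − j)` (`2j ≤ n`, `j ≤ n`). -/
theorem sW_ge {j : ℕ} {B : Finset α} (hB : B.card = j) (X : Finset α) (hn : 2 * j ≤ Fintype.card α)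
    (hjn : j < Fintype.card α) (y : α) :
    (1 - eDef α j (X ∩ B).card) / ((Fintype.card α : ℚ) - j) ≤ sW α j (dFlux α j) B X y := by
  have hnj : (0 : ℚ) < (Fintype.card α : ℚ) - j := by
    have : (j : ℚ) < Fintype.card α := by exact_mod_cast hjn
    linarith
  have ha : aOf B X = (X ∩ B).card := rfl
  have hd : 0 ≤ dFlux α j (X ∩ B).card := dFlux_nonneg hjn.le
  have hcard : (X ∩ B).card ≤ j := hB ▸ card_le_card inter_subset_right
  have hac : ((X ∩ B).card : ℚ) ≤ j := by exact_mod_cast hcard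
  unfold sW
  rw [ha]
  split_ifs with hyB
  · unfold win
    apply div_le_div_of_nonneg_right _ hnj.le
    unfold eDef
    have h1 : (0 : ℚ) ≤ (Fintype.card α : ℚ) - 2 * j + (X ∩ B).card := by
      have : (2 * j : ℚ) ≤ Fintype.card α := by exact_mod_cast hn
      have : (0 : ℚ) ≤ ((X ∩ B).card : ℚ) := by positivity
      linarith
    have h2 := mul_nonneg h1 hd
    have h3 := mul_nonneg (sub_nonneg.2 hac) hd
    linarith
  · unfold wout eDef
    exact le_refl _

/-- **The superposition is at least `(1 − N(X))/(n − j)`** at every `X ∈ P`, `y ∉ X` (`2j ≤ n`, `j < n`). -/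
theorem superW_ge {j : ℕ} {D : Finset (Finset α)} (hD : IsCode j D) (hn : 2 * j ≤ Fintype.card α)
    (hjn : j < Fintype.card α) (X : Finset α) (y : α) :
    (1 - ∑ B ∈ D, eDef α j (X ∩ B).card) / ((Fintype.card α : ℚ) - j) ≤ superW α j D X y := by
  unfold superW
  have h1 : ∑ B ∈ D, (1 - eDef α j (X ∩ B).card) / ((Fintype.card α : ℚ) - j) ≤
      ∑ B ∈ D, sW α j (dFlux α j) B X y :=
    sum_le_sum (fun B hB => sW_ge (hD.1 B hB) X hn hjn y)
  rw [← sum_div, sum_sub_distrib, sum_const, nsmul_eq_mul, mul_one] at h1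
  have hnj : ((Fintype.card α : ℚ) - j) ≠ 0 := by
    have : (j : ℚ) < Fintype.card α := by exact_mod_cast hjn
    linarith
  have : (1 - ∑ B ∈ D, eDef α j (X ∩ B).card) / ((Fintype.card α : ℚ) - j) =
      ((D.card : ℚ) - ∑ B ∈ D, eDef α j (X ∩ B).card) / ((Fintype.card α : ℚ) - j)
        - ((D.card : ℚ) - 1) / ((Fintype.card α : ℚ) - j) := by
    field_simp
    ring
  rw [this]
  linarith

/-! ### The positive error is at most `N'(B)` -/

/-- **The error of a word is at most `N'(B)/(n − j)`**, `N'(B) = Σ_{B' ∈ D, B' ≠ B} e(#(B ∩ B'))` (`2j ≤ n`, `j < n`). -/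
theorem errE_le {j : ℕ} {D : Finset (Finset α)} (hD : IsCode j D) (hn : 2 * j ≤ Fintype.card α)
    (hjn : j < Fintype.card α) (B : Finset α) (y : α) :
    errE α j D B y ≤ (∑ B' ∈ D.erase B, eDef α j (B ∩ B').card) / ((Fintype.card α : ℚ) - j) := by
  unfold errE
  rw [sum_div]
  apply sum_le_sum
  intro B' hB'
  have hnj : (0 : ℚ) < (Fintype.card α : ℚ) - j := by
    have : (j : ℚ) < Fintype.card α := by exact_mod_cast hjn
    linarith
  have := sW_ge (hD.1 B' (mem_of_mem_erase hB')) B hn hjn y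
  have e : 1 / ((Fintype.card α : ℚ) - j) - (1 - eDef α j (B ∩ B').card) / ((Fintype.card α : ℚ) - j) =
      eDef α j (B ∩ B').card / ((Fintype.card α : ℚ) - j) := by
    field_simp
    ring
  linarith

/-- The positive part of the error is at most `N'(B)/(n − j)`. -/
theorem max_errE_le {j : ℕ} {D : Finset (Finset α)} (hD : IsCode j D) (hn : 2 * j ≤ Fintype.card α)
    (hjn : j < Fintype.card α) {B : Finset α} (hB : B ∈ D) (y : α) :
    max (errE α j D B y) 0 ≤ (∑ B' ∈ D.erase B, eDef α j (B ∩ B').card) / ((Fintype.card α : ℚ) - j) := by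
  apply max_le (errE_le hD hn hjn B y)
  apply div_nonneg
  · exact sum_nonneg (fun B' hB' => eDef_nonneg ((hD.1 B hB) ▸ card_le_card inter_subset_left) hjn.le)
  · have : (j : ℚ) < Fintype.card α := by exact_mod_cast hjn
    linarith

omit [Fintype α] in
/-- A subfamily of a code is a code. -/
theorem isCode_erase {j : ℕ} {D : Finset (Finset α)} (hD : IsCode j D) (B : Finset α) : IsCode j (D.erase B) :=
  ⟨fun B' hB' => hD.1 B' (mem_of_mem_erase hB'),
   fun B' hB' B'' hB'' hne => hD.2 B' (mem_of_mem_erase hB') B'' (mem_of_mem_erase hB'') hne⟩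

/-- **`N'(B) ≤ j/(n − j + 1)`** for every word `B ∈ D` (`1 ≤ j`, `2j + 1 ≤ n`). -/
theorem sum_eDef_erase_le {j : ℕ} {D : Finset (Finset α)} (hD : IsCode j D) (hj : 1 ≤ j)
    (hn : 2 * j + 1 ≤ Fintype.card α) {B : Finset α} (hB : B ∈ D) :
    ∑ B' ∈ D.erase B, eDef α j (B ∩ B').card ≤ (j : ℚ) / ((Fintype.card α : ℚ) - j + 1) :=
  sum_eDef_le (isCode_erase hD B) hj hn (hD.1 B hB) (notMem_erase B D)

/-! ### Theorem A -/

/-- **The corrected weights are nonnegative when `3j ≤ n + 1`** (`1 ≤ j`, `2j + 1 ≤ n`): in units of `1/(n−j)`,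
`totalW ≥ 1 − N(X) − max errE⁺·(n−j) ≥ 1 − 2j/(n − j + 1) ≥ 0`. -/
theorem totalW_nonneg {j : ℕ} {D : Finset (Finset α)} (hD : IsCode j D) (hj : 1 ≤ j)
    (hn : 2 * j + 1 ≤ Fintype.card α) (h3 : 3 * j ≤ Fintype.card α + 1) {X : Finset α} (hX : X ∈ punctured j D)
    {y : α} (hy : y ∉ X) : 0 ≤ totalW α j D X y := by
  obtain ⟨hXc, hXD⟩ := mem_punctured.1 hX
  have hjn : j < Fintype.card α := by omega
  have hn2 : 2 * j ≤ Fintype.card α := by omega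
  have hnj : (0 : ℚ) < (Fintype.card α : ℚ) - j := by
    have : (j : ℚ) < Fintype.card α := by exact_mod_cast hjn
    linarith
  have hnj1 : (0 : ℚ) < (Fintype.card α : ℚ) - j + 1 := by linarith
  set M : ℚ := (j : ℚ) / ((Fintype.card α : ℚ) - j + 1) / ((Fintype.card α : ℚ) - j) with hM_def
  have hM0 : 0 ≤ M := by positivity
  have hM : ∀ B ∈ D, ∀ y' ∉ B, max (errE α j D B y') 0 ≤ M := by
    intro B hB y' _
    calc max (errE α j D B y') 0
        ≤ (∑ B' ∈ D.erase B, eDef α j (B ∩ B').card) / ((Fintype.card α : ℚ) - j) := max_errE_le hD hn2 hjn hB y'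
      _ ≤ M := by
          rw [hM_def]
          exact div_le_div_of_nonneg_right (sum_eDef_erase_le hD hj hn hB) hnj.le
  have h1 := superW_ge hD hn2 hjn X y
  have h2 := sum_reroute_ge hD hjn hM0 hM hXc hy
  have hN := sum_eDef_le hD hj hn hXc hXD
  unfold totalW
  -- `(1 − N)/(n−j) − M ≥ (1 − 2j/(n−j+1))/(n−j) ≥ 0`
  have h3q : (2 * j : ℚ) ≤ (Fintype.card α : ℚ) - j + 1 := by
    have : (3 * j : ℚ) ≤ Fintype.card α + 1 := by exact_mod_cast h3
    linarith
  have hkey : 0 ≤ (1 - ∑ B ∈ D, eDef α j (X ∩ B).card) / ((Fintype.card α : ℚ) - j) - M := by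
    rw [hM_def, ← sub_div]
    apply div_nonneg _ hnj.le
    have : (j : ℚ) / ((Fintype.card α : ℚ) - j + 1) + (j : ℚ) / ((Fintype.card α : ℚ) - j + 1) ≤ 1 := by
      rw [← add_div, div_le_one hnj1]
      linarith
    linarith
  linarith

/-- **THEOREM A: (SP) holds for every code `D ⊆ C([n], j)` with `1 ≤ j`, `2j + 1 ≤ n` and `3j ≤ n + 1`.** -/
theorem puncturedNMP_of_three_j {j : ℕ} {D : Finset (Finset α)} (hD : IsCode j D) (hj : 1 ≤ j)
    (hn : 2 * j + 1 ≤ Fintype.card α) (h3 : 3 * j ≤ Fintype.card α + 1) : PuncturedNMP j D := by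
  have hjn : j < Fintype.card α := by omega
  have hj0 : 0 < j := hj
  set c : ℚ := ((punctured j D).card : ℚ) / (levelAbove α j).card with hc_def
  have hc0 : 0 ≤ c := by positivity
  refine puncturedNMP_of_weights (fun X Y => totalWp α j D X Y / c) ?_ ?_ ?_
  · -- nonnegativity
    intro X hX Y hY
    have hXc := (mem_punctured.1 hX).1
    rw [sups_eq hXc] at hY
    obtain ⟨y, hy, rfl⟩ := mem_image.1 hY
    rw [totalWp_insert j D X (mem_sdiff.1 hy).2]
    exact div_nonneg (totalW_nonneg hD hj hn h3 hX (mem_sdiff.1 hy).2) hc0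
  · -- row sums: `1 / c = #Y / #P`
    intro X hX
    rw [← sum_div, sum_sups_totalWp hD hjn hX, hc_def, one_div_div]
  · -- column sums: exactly `c`
    intro Y hY
    rw [← sum_div, sum_subsP_totalWp hD hj0 hjn (mem_levelAbove.1 hY), ← hc_def]
    rcases eq_or_ne c 0 with hc | hc
    · rw [hc, div_zero]
      exact zero_le_one
    · rw [div_self hc]

end PercRepro.PuncturedLYM
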